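import Literature.Analysis.FluidPDE.SliceIdentities
import Literature.Analysis.FluidPDE.RepresentedDerivativesCalculus
import Literature.Analysis.FluidPDE.LaplaceVeryWeakGradient
import Literature.Analysis.FunctionSpaces.LpNormByDuality
import HarnessLib

/-!
# Space–time `L²` gradients of very weak Poisson solutions (the sliced elliptic step)

Analysis/FluidPDE file (sequel to `SliceIdentities`, `LaplaceVeryWeakGradient`,
`RepresentedDerivatives`). In the Serrin bootstrap for bounded distributional Navier–Stokes
solutions (Serrin 1962; Lemarié-Rieusset 2016, Thm. 13.1; Seregin–Šverák 2009, §2) the velocity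
components satisfy, at each level of differentiation, a very weak Poisson equation in divergence
form on a space–time cylinder, `∫ U Δψ = -Σ_c ∫ A_c ∂_cψ` (from `Δu_b = Σ_c ∂_c(∂_c u_b - ∂_b u_c)`
and incompressibility), with `U, A_c ∈ L²`. This file proves the quantitative consequence used by
the bootstrap (`exists_L2_partial_of_poisson`): on every spatially smaller cylinder each
distributional derivative `∂ᵢU` is represented by an `L²` function `G` with
`‖G‖_{L²(Q')} ≤ C(ρ, R) (‖U‖_{L²(Q)} + Σ_c ‖A_c‖_{L²(Q)})`.

Proof: slice the identity a.e. in `t` simultaneously for all test functions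
(`RepDeriv.ae_slice_identity_sum`); at a good time the slice is a very weak `L²` solution of
`ΔU(t) = div A(t)` on `B(0, R)`, hence `W^{1,2}` on `B(0, ρ)` with the bound
(`LaplaceVeryWeak.exists_weakGrad_of_veryWeak`, Gilbarg–Trudinger §8.3); Tonelli and
Cauchy–Schwarz in time bound the functional `Ξ ↦ ∫ U ∂ᵢΞ` on `L²(Q')`, and Riesz–Fréchet
(`HeatDivForm.exists_memLp_two_repr_of_test_bound`) represents it.

## References

* J. Serrin, Arch. Rational Mech. Anal. 9 (1962) 187–195. [folklore]
* D. Gilbarg, N. Trudinger, *Elliptic Partial Differential Equations of Second Order* (2001),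
  §8.3. [`GilbargTrudinger2001`]
* P. G. Lemarié-Rieusset, *The Navier–Stokes Problem in the 21st Century* (2016), Thm. 13.1.
  [`LemarieRieusset2016`]
-/

noncomputable section

open MeasureTheory Set Function Filter Topology TopologicalSpace Metric
open scoped NNReal ENNReal

namespace Literature.Analysis.FluidPDE

namespace RepDeriv

open Literature.Analysis.FunctionSpaces
open scoped Laplacian RealInnerProductSpace

/-! ### Slices of `L²` functions on products -/

section SliceL2

variable {X Y : Type*} [MeasurableSpace X] [MeasurableSpace Y] {μ : Measure X} {ν : Measure Y}
  [SFinite μ] [SFinite ν]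

/-- Almost every slice of an `L²` function on a product is in `L²` (Tonelli). [folklore] -/
theorem ae_memLp_two_slice {U : X × Y → ℝ} (hU : MemLp U 2 (μ.prod ν)) :
    ∀ᵐ t ∂μ, MemLp (fun x => U (t, x)) 2 ν := by
  filter_upwards [hU.integrable_sq.prod_right_ae, hU.1.prodMk_left] with t ht hm
  exact (memLp_two_iff_integrable_sq hm).2 ht

omit [SFinite μ] [SFinite ν] in
/-- `‖f‖_{L²}² = ∫ ‖f‖ₑ²`. [folklore] -/
theorem eLpNorm_two_rpow_two {α : Type*} [MeasurableSpace α] {μ' : Measure α} (f : α → ℝ) :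
    eLpNorm f 2 μ' ^ (2 : ℝ) = ∫⁻ x, ‖f x‖ₑ ^ (2 : ℝ) ∂μ' := by
  have h := eLpNorm_nnreal_pow_eq_lintegral (μ := μ') (f := f) (p := (2 : ℝ≥0)) two_ne_zero
  simpa using h

omit [SFinite μ] [SFinite ν] in
/-- `‖f‖_{L²} = (∫ ‖f‖ₑ²)^{1/2}`. [folklore] -/
theorem eLpNorm_two_eq_rpow_half {α : Type*} [MeasurableSpace α] {μ' : Measure α} (f : α → ℝ) :
    eLpNorm f 2 μ' = (∫⁻ x, ‖f x‖ₑ ^ (2 : ℝ) ∂μ') ^ (1 / 2 : ℝ) := by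
  rw [eLpNorm_eq_lintegral_rpow_enorm_toReal two_ne_zero ENNReal.ofNat_ne_top]
  norm_num

omit [SFinite μ] in
/-- The `L²` norms of the slices are a.e.-measurable. [folklore] -/
theorem aemeasurable_eLpNorm_slice {U : X × Y → ℝ} (hU : AEStronglyMeasurable U (μ.prod ν)) :
    AEMeasurable (fun t => eLpNorm (fun x => U (t, x)) 2 ν) μ := by
  simp_rw [eLpNorm_two_eq_rpow_half]
  exact ((hU.enorm.pow_const _).lintegral_prod_right').pow_const _

omit [SFinite μ] in
/-- **Tonelli for `L²` norms of slices**: `(∫ ‖U(t, ·)‖²_{L²} dt)^{1/2} = ‖U‖_{L²}`. [folklore] -/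
theorem lintegral_eLpNorm_slice_rpow {U : X × Y → ℝ} (hU : AEStronglyMeasurable U (μ.prod ν)) :
    (∫⁻ t, eLpNorm (fun x => U (t, x)) 2 ν ^ (2 : ℝ) ∂μ) ^ (1 / 2 : ℝ) = eLpNorm U 2 (μ.prod ν) := by
  simp_rw [eLpNorm_two_rpow_two]
  rw [← lintegral_prod _ (hU.enorm.pow_const _), eLpNorm_two_eq_rpow_half]

omit [SFinite μ] [SFinite ν] in
/-- **Minkowski for finitely many `ℝ≥0∞`-valued functions** (`1 ≤ p`). [folklore] -/
theorem lintegral_Lp_finset_sum_le {α ι' : Type*} [MeasurableSpace α] {μ' : Measure α} {p : ℝ}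
    (hp : 1 ≤ p) (s : Finset ι') {f : ι' → α → ℝ≥0∞} (hf : ∀ i ∈ s, AEMeasurable (f i) μ') :
    (∫⁻ a, (∑ i ∈ s, f i a) ^ p ∂μ') ^ (1 / p) ≤ ∑ i ∈ s, (∫⁻ a, f i a ^ p ∂μ') ^ (1 / p) := by
  classical
  induction s using Finset.induction_on with
  | empty =>
    have hp0 : 0 < p := lt_of_lt_of_le zero_lt_one hp
    simp [ENNReal.zero_rpow_of_pos hp0, hp0]
  | insert a s ha ih =>
    have hf' : ∀ i ∈ s, AEMeasurable (f i) μ' := fun i hi => hf i (Finset.mem_insert_of_mem hi)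
    have hs : AEMeasurable (fun x => ∑ i ∈ s, f i x) μ' := Finset.aemeasurable_fun_sum s hf'
    rw [Finset.sum_insert ha]
    have h1 := ENNReal.lintegral_Lp_add_le (hf a (Finset.mem_insert_self a s)) hs hp
    simp only [Pi.add_apply] at h1
    simp_rw [Finset.sum_insert ha]
    exact h1.trans (add_le_add le_rfl (ih hf'))

end SliceL2

/-! ### Geometry of `ℝ³`-valued fields built from components -/

section Components

/-- The Euclidean vector with prescribed components. [folklore] -/
theorem toLp_apply_fin (a : Fin 3 → ℝ) (c : Fin 3) :
    (WithLp.toLp 2 a : EuclideanSpace ℝ (Fin 3)) c = a c := rfl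

/-- `‖(a_c)_c‖ ≤ Σ_c |a_c|` in `ℝ³`. [folklore] -/
theorem norm_toLp_le_sum_abs (a : Fin 3 → ℝ) :
    ‖(WithLp.toLp 2 a : EuclideanSpace ℝ (Fin 3))‖ ≤ ∑ c, |a c| := by
  set v : EuclideanSpace ℝ (Fin 3) := WithLp.toLp 2 a with hv
  have h := (EuclideanSpace.basisFun (Fin 3) ℝ).sum_repr' v
  calc ‖v‖ = ‖∑ c, ⟪EuclideanSpace.basisFun (Fin 3) ℝ c, v⟫ • EuclideanSpace.basisFun (Fin 3) ℝ c‖ := by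
        rw [h]
    _ ≤ ∑ c, ‖⟪EuclideanSpace.basisFun (Fin 3) ℝ c, v⟫ • EuclideanSpace.basisFun (Fin 3) ℝ c‖ :=
        norm_sum_le _ _
    _ = ∑ c, |a c| := by
        refine Finset.sum_congr rfl fun c _ => ?_
        rw [norm_smul, (EuclideanSpace.basisFun (Fin 3) ℝ).orthonormal.1 c, mul_one,
          EuclideanSpace.basisFun_inner, Real.norm_eq_abs]

end Components

/-! ### The sliced elliptic estimate -/

section Poisson

variable {L ρ R : ℝ}

/-- `derivs vs ψ t = sderivs vs (ψ t)`. [folklore] -/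
theorem derivs_apply_eq_sderivs {E F : Type*} [NormedAddCommGroup E] [NormedSpace ℝ E]
    [NormedAddCommGroup F] [NormedSpace ℝ F] (vs : List E) (ψ : ℝ → E → F) (t : ℝ) :
    derivs vs ψ t = sderivs vs (ψ t) := by
  induction vs generalizing ψ with
  | nil => rfl
  | cons v vs ih => exact ih _

/-- The Laplacian as the sum of the pure second `sderivs` along the standard basis. [folklore] -/
theorem laplacian_eq_sum_sderivs {φ : EuclideanSpace ℝ (Fin 3) → ℝ} (hφ : ContDiff ℝ 2 φ)
    (x : EuclideanSpace ℝ (Fin 3)) :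
    (Δ φ) x = ∑ j, sderivs [EuclideanSpace.basisFun (Fin 3) ℝ j, EuclideanSpace.basisFun (Fin 3) ℝ j] φ x :=
  laplacian_eq_sum_fderiv_fderiv_normed (EuclideanSpace.basisFun (Fin 3) ℝ) hφ x

/-- Time slices of a space–time test function on `S × Ω` are test functions on `Ω`. [folklore] -/
theorem isTestFunctionOn_slice_of_subset_prod {E : Type*} [NormedAddCommGroup E] [NormedSpace ℝ E]
    {Q : Opens (ℝ × E)} {S : Set ℝ} {Ω : Opens E}
    (hQ : (Q : Set (ℝ × E)) ⊆ S ×ˢ (Ω : Set E)) {ψ : ℝ → E → ℝ} (hψ : IsSpaceTimeTestOn Q ψ)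
    (t : ℝ) : IsTestFunctionOn Ω (ψ t) := by
  refine ⟨hψ.contDiff_slice t, hψ.hasCompactSupport_slice t, ?_⟩
  intro x hx
  have hsub : tsupport (ψ t) ⊆ (fun y => (t, y)) ⁻¹' tsupport (uncurry ψ) :=
    closure_minimal (fun y hy => subset_tsupport _ (by simpa using hy))
      ((isClosed_tsupport _).preimage (Continuous.prodMk_right t))
  exact (hQ (hψ.tsupport_subset (hsub hx))).2

/-- **Space–time `L²` gradient of very weak Poisson solutions in divergence form, with the bound.**
Let `Q = ]-L, 0[ × B(0, R)` and `Q' = ]-L, 0[ × B(0, ρ)`, `0 < ρ < R`. There is `C = C(ρ, R)` such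
that for all `U, A₀, A₁, A₂ ∈ L²(Q)` with `∫ U Δψ = -Σ_c ∫ A_c ∂_cψ` for every space–time test
function `ψ` on `Q`, and every coordinate direction `eᵢ`, the distributional derivative `∂ᵢU` is
represented on `Q'` by a function `G ∈ L²(Q')` with
`‖G‖_{L²(Q')} ≤ C (‖U‖_{L²(Q)} + Σ_c ‖A_c‖_{L²(Q)})`. Proof: for a.e. `t` the slice `U(t, ·)` is
a very weak `L²` solution of `ΔU(t) = div A(t)` on `B(0, R)` (`ae_slice_identity_sum`), hence
`W^{1,2}` on `B(0, ρ)` with `‖∇U(t)‖_{L²(B_ρ)} ≤ C (‖U(t)‖_{L²(B_R)} + ‖A(t)‖_{L²(B_R)})`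
(`LaplaceVeryWeak.exists_weakGrad_of_veryWeak`); Cauchy–Schwarz in `t` bounds the functional
`Ξ ↦ ∫ U ∂ᵢΞ` on `L²(Q')`, and Riesz–Fréchet represents it (Serrin 1962; Gilbarg–Trudinger, Thm.
8.8 / §8.3). [folklore] -/
theorem exists_L2_partial_of_poisson (hρ : 0 < ρ) (hρR : ρ < R) :
    ∃ C : ℝ≥0, ∀ (U : ℝ × EuclideanSpace ℝ (Fin 3) → ℝ) (A : Fin 3 → ℝ × EuclideanSpace ℝ (Fin 3) → ℝ),
      MemLp U 2 (volume.restrict (Ioo (-L) 0 ×ˢ ball (0 : EuclideanSpace ℝ (Fin 3)) R)) →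
      (∀ c, MemLp (A c) 2 (volume.restrict (Ioo (-L) 0 ×ˢ ball (0 : EuclideanSpace ℝ (Fin 3)) R))) →
      (∀ ψ : ℝ → EuclideanSpace ℝ (Fin 3) → ℝ,
        IsSpaceTimeTestOn (⟨Ioo (-L) 0 ×ˢ ball (0 : EuclideanSpace ℝ (Fin 3)) R,
          isOpen_Ioo.prod isOpen_ball⟩ : Opens (ℝ × EuclideanSpace ℝ (Fin 3))) ψ →
        ∫ q : ℝ × EuclideanSpace ℝ (Fin 3), U q * (Δ (ψ q.1)) q.2 =
          -∑ c, ∫ q : ℝ × EuclideanSpace ℝ (Fin 3),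
            A c q * fderiv ℝ (ψ q.1) q.2 (EuclideanSpace.basisFun (Fin 3) ℝ c)) →
      ∀ i : Fin 3, ∃ G : ℝ × EuclideanSpace ℝ (Fin 3) → ℝ,
        MemLp G 2 (volume.restrict (Ioo (-L) 0 ×ˢ ball (0 : EuclideanSpace ℝ (Fin 3)) ρ)) ∧
        eLpNorm G 2 (volume.restrict (Ioo (-L) 0 ×ˢ ball (0 : EuclideanSpace ℝ (Fin 3)) ρ)) ≤
          C * (eLpNorm U 2 (volume.restrict (Ioo (-L) 0 ×ˢ ball (0 : EuclideanSpace ℝ (Fin 3)) R)) +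
            ∑ c, eLpNorm (A c) 2
              (volume.restrict (Ioo (-L) 0 ×ˢ ball (0 : EuclideanSpace ℝ (Fin 3)) R))) ∧
        IsRepDeriv (⟨Ioo (-L) 0 ×ˢ ball (0 : EuclideanSpace ℝ (Fin 3)) ρ,
          isOpen_Ioo.prod isOpen_ball⟩ : Opens (ℝ × EuclideanSpace ℝ (Fin 3))) U
          [EuclideanSpace.basisFun (Fin 3) ℝ i] G := by
  obtain ⟨C₃, hC₃⟩ := LaplaceVeryWeak.exists_weakGrad_of_veryWeak hρ hρR
  refine ⟨C₃, fun U A hU hA hid i => ?_⟩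
  -- notation
  set e : Fin 3 → EuclideanSpace ℝ (Fin 3) := fun c => EuclideanSpace.basisFun (Fin 3) ℝ c with he
  set I : Set ℝ := Ioo (-L) 0 with hI
  set BR : Set (EuclideanSpace ℝ (Fin 3)) := ball 0 R with hBR
  set Bρ : Set (EuclideanSpace ℝ (Fin 3)) := ball 0 ρ with hBρ
  set Qs : Set (ℝ × EuclideanSpace ℝ (Fin 3)) := I ×ˢ BR with hQs
  set Qs' : Set (ℝ × EuclideanSpace ℝ (Fin 3)) := I ×ˢ Bρ with hQs'
  set Qo : Opens (ℝ × EuclideanSpace ℝ (Fin 3)) := ⟨Qs, isOpen_Ioo.prod isOpen_ball⟩ with hQo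
  set Qo' : Opens (ℝ × EuclideanSpace ℝ (Fin 3)) := ⟨Qs', isOpen_Ioo.prod isOpen_ball⟩ with hQo'
  set ΩR : Opens (EuclideanSpace ℝ (Fin 3)) := ⟨BR, isOpen_ball⟩ with hΩR
  set Ωρ : Opens (EuclideanSpace ℝ (Fin 3)) := ⟨Bρ, isOpen_ball⟩ with hΩρ
  have hBρR : Bρ ⊆ BR := ball_subset_ball hρR.le
  have hQ'Q : Qs' ⊆ Qs := prod_mono Subset.rfl hBρR
  have hQo'o : Qo' ≤ Qo := hQ'Q
  have hQmeas : MeasurableSet Qs := (isOpen_Ioo.prod isOpen_ball).measurableSet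
  have hQ'meas : MeasurableSet Qs' := (isOpen_Ioo.prod isOpen_ball).measurableSet
  have hQfin : volume Qs < ⊤ := by
    rw [hQs, Measure.volume_eq_prod, Measure.prod_prod]
    exact ENNReal.mul_lt_top (by simp [hI, Real.volume_Ioo]) measure_ball_lt_top
  have hQ'fin : volume Qs' < ⊤ := lt_of_le_of_lt (measure_mono hQ'Q) hQfin
  have hprod : (volume : Measure (ℝ × EuclideanSpace ℝ (Fin 3))).restrict Qs =
      (volume.restrict I).prod (volume.restrict BR) := by
    rw [hQs, Measure.volume_eq_prod, Measure.prod_restrict]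
  have hprod' : (volume : Measure (ℝ × EuclideanSpace ℝ (Fin 3))).restrict Qs' =
      (volume.restrict I).prod (volume.restrict Bρ) := by
    rw [hQs', Measure.volume_eq_prod, Measure.prod_restrict]
  haveI : IsFiniteMeasure ((volume : Measure (ℝ × EuclideanSpace ℝ (Fin 3))).restrict Qs) :=
    isFiniteMeasure_restrict.2 hQfin.ne
  haveI hBRfin : IsFiniteMeasure ((volume : Measure (EuclideanSpace ℝ (Fin 3))).restrict BR) :=
    isFiniteMeasure_restrict.2 measure_ball_lt_top.ne
  -- local integrability on `Q`
  have hUli : LocallyIntegrableOn U Qs volume :=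
    IntegrableOn.locallyIntegrableOn (hU.integrable one_le_two)
  have hAli : ∀ c, LocallyIntegrableOn (A c) Qs volume := fun c =>
    IntegrableOn.locallyIntegrableOn ((hA c).integrable one_le_two)
  ---------------------------------------------------------------------------------------------
  -- Step 1: `L²` slices and their norms
  ---------------------------------------------------------------------------------------------
  have hUs : ∀ᵐ t ∂(volume.restrict I), MemLp (fun x => U (t, x)) 2 (volume.restrict BR) :=
    ae_memLp_two_slice (hprod ▸ hU)
  have hAs : ∀ᵐ t ∂(volume.restrict I), ∀ c, MemLp (fun x => A c (t, x)) 2 (volume.restrict BR) :=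
    ae_all_iff.2 fun c => ae_memLp_two_slice (hprod ▸ hA c)
  have hmU_meas : AEMeasurable (fun t => eLpNorm (fun x => U (t, x)) 2 (volume.restrict BR))
      (volume.restrict I) := aemeasurable_eLpNorm_slice (hprod ▸ hU).1
  have hmA_meas : ∀ c, AEMeasurable (fun t => eLpNorm (fun x => A c (t, x)) 2 (volume.restrict BR))
      (volume.restrict I) := fun c => aemeasurable_eLpNorm_slice (hprod ▸ hA c).1
  have hmU_L2 : (∫⁻ t in I, eLpNorm (fun x => U (t, x)) 2 (volume.restrict BR) ^ (2 : ℝ)) ^ (1 / 2 : ℝ)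
      = eLpNorm U 2 (volume.restrict Qs) := by
    rw [hprod]; exact lintegral_eLpNorm_slice_rpow (hprod ▸ hU).1
  have hmA_L2 : ∀ c, (∫⁻ t in I, eLpNorm (fun x => A c (t, x)) 2 (volume.restrict BR) ^ (2 : ℝ)) ^
      (1 / 2 : ℝ) = eLpNorm (A c) 2 (volume.restrict Qs) := by
    intro c; rw [hprod]; exact lintegral_eLpNorm_slice_rpow (hprod ▸ hA c).1
  ---------------------------------------------------------------------------------------------
  -- Step 2: slicing the Poisson identity
  ---------------------------------------------------------------------------------------------
  have hslice : ∀ᵐ t ∂(volume.restrict I), ∀ φ : EuclideanSpace ℝ (Fin 3) → ℝ,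
      IsTestFunctionOn ΩR φ →
        ∫ x, U (t, x) * (Δ φ) x = -∑ c, ∫ x, A c (t, x) * fderiv ℝ φ x (e c) := by
    -- the data of `ae_slice_identity_sum`
    set h : Fin 3 ⊕ Fin 3 → ℝ × EuclideanSpace ℝ (Fin 3) → ℝ := fun m => Sum.elim (fun _ => U) A m
      with hh
    set ds : Fin 3 ⊕ Fin 3 → List (EuclideanSpace ℝ (Fin 3)) :=
      fun m => Sum.elim (fun j => [e j, e j]) (fun c => [e c]) m with hds
    have hhli : ∀ m, LocallyIntegrableOn (h m) (Ioo (-L) 0 ×ˢ (ΩR : Set (EuclideanSpace ℝ (Fin 3))))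
        volume := by
      rintro (j | c)
      · exact hUli
      · exact hAli c
    have hdsl : ∀ m, (ds m).length ≤ 2 := by
      rintro (j | c) <;> simp [hds]
    have hid' : ∀ ψ : ℝ → EuclideanSpace ℝ (Fin 3) → ℝ, IsSpaceTimeTestOn
        (⟨Ioo (-L) 0 ×ˢ (ΩR : Set (EuclideanSpace ℝ (Fin 3))), isOpen_Ioo.prod ΩR.isOpen⟩ :
          Opens (ℝ × EuclideanSpace ℝ (Fin 3))) ψ →
        ∑ m, ∫ q : ℝ × EuclideanSpace ℝ (Fin 3), h m q * derivs (ds m) ψ q.1 q.2 = 0 := by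
      intro ψ hψ
      have hψ' : IsSpaceTimeTestOn Qo ψ := hψ
      rw [Fintype.sum_sum_type]
      simp only [hh, hds, Sum.elim_inl, Sum.elim_inr]
      -- the `U`-terms sum to `∫ U Δψ`
      have hlap : ∑ j, ∫ q : ℝ × EuclideanSpace ℝ (Fin 3), U q * derivs [e j, e j] ψ q.1 q.2 =
          ∫ q : ℝ × EuclideanSpace ℝ (Fin 3), U q * (Δ (ψ q.1)) q.2 := by
        rw [← integral_finsetSum _ fun j _ => (isRepDeriv_nil hUli).integrable_mul' (hψ'.derivs _)]
        refine integral_congr_ae (Eventually.of_forall fun q => ?_)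
        dsimp only
        rw [← Finset.mul_sum]
        congr 1
        have h2 : ContDiff ℝ 2 (ψ q.1) := (hψ'.contDiff_slice q.1).of_le (by norm_cast)
        rw [laplacian_eq_sum_sderivs h2]
        refine Finset.sum_congr rfl fun j _ => ?_
        rw [derivs_apply_eq_sderivs]
      have hfirst : ∀ c, ∫ q : ℝ × EuclideanSpace ℝ (Fin 3), A c q * derivs [e c] ψ q.1 q.2 =
          ∫ q : ℝ × EuclideanSpace ℝ (Fin 3), A c q * fderiv ℝ (ψ q.1) q.2 (e c) := fun c => rfl
      rw [hlap, hid ψ hψ']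
      simp_rw [hfirst]
      ring
    have hs := ae_slice_identity_sum hhli hdsl hid'
    filter_upwards [hs, hUs] with t ht hUt
    intro φ hφ
    have h0 := ht φ hφ
    rw [Fintype.sum_sum_type] at h0
    simp only [hh, hds, Sum.elim_inl, Sum.elim_inr] at h0
    -- convert the `U`-terms
    have hφc : Continuous φ := hφ.contDiff.continuous
    have hUt_int : IntegrableOn (fun x => U (t, x)) (tsupport φ) volume :=
      IntegrableOn.mono_set (hUt.integrable one_le_two) hφ.tsupport_subset
    have hlap : ∑ j, ∫ x, U (t, x) * sderivs [e j, e j] φ x = ∫ x, U (t, x) * (Δ φ) x := by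
      have hint : ∀ j, Integrable (fun x => U (t, x) * sderivs [e j, e j] φ x)
          (volume : Measure (EuclideanSpace ℝ (Fin 3))) := by
        intro j
        have := integrable_mul_of_eq_zero_off_compact hφ.hasCompactSupport
          (contDiff_sderivs [e j, e j] hφ.contDiff).continuous
          (fun x hx => sderivs_eq_zero_of_notMem_tsupport [e j, e j] hx) hUt_int
        simpa only [mul_comm] using this
      rw [← integral_finsetSum _ fun j _ => hint j]
      refine integral_congr_ae (Eventually.of_forall fun x => ?_)
      dsimp only
      rw [← Finset.mul_sum, laplacian_eq_sum_sderivs (hφ.contDiff.of_le (by norm_cast))]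
    have hfirst : ∀ c, ∫ x, A c (t, x) * sderivs [e c] φ x = ∫ x, A c (t, x) * fderiv ℝ φ x (e c) :=
      fun c => rfl
    rw [hlap] at h0
    simp_rw [hfirst] at h0
    linarith
  ---------------------------------------------------------------------------------------------
  -- Step 3: the bound at almost every fixed time (elliptic estimate on the slice)
  ---------------------------------------------------------------------------------------------
  have hpt : ∀ᵐ t ∂(volume.restrict I), ∀ Ξ : ℝ → EuclideanSpace ℝ (Fin 3) → ℝ,
      IsSpaceTimeTestOn Qo' Ξ →
        ‖∫ x, U (t, x) * fderiv ℝ (Ξ t) x (e i)‖ₑ ≤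
          C₃ * (eLpNorm (fun x => U (t, x)) 2 (volume.restrict BR) +
              ∑ c, eLpNorm (fun x => A c (t, x)) 2 (volume.restrict BR)) *
            eLpNorm (Ξ t) 2 (volume.restrict Bρ) := by
    filter_upwards [hslice, hUs, hAs] with t hsl hUt hAt
    intro Ξ hΞ
    -- the vector field of the `A_c(t, ·)`
    set F : EuclideanSpace ℝ (Fin 3) → EuclideanSpace ℝ (Fin 3) :=
      fun x => WithLp.toLp 2 (fun c => A c (t, x)) with hF
    have hFc : ∀ x c, F x c = A c (t, x) := fun x c => rfl
    have hFmeas : AEStronglyMeasurable F (volume.restrict BR) := by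
      have h1 : AEMeasurable (fun x => fun c => A c (t, x)) (volume.restrict BR) :=
        aemeasurable_pi_lambda _ fun c => (hAt c).1.aemeasurable
      exact ((PiLp.continuous_toLp 2 (fun _ : Fin 3 => ℝ)).measurable.comp_aemeasurable h1).aestronglyMeasurable
    have hgL : MemLp (fun x => ∑ c, ‖A c (t, x)‖) 2 (volume.restrict BR) :=
      memLp_finsetSum _ fun c _ => (hAt c).norm
    have hFle : ∀ x, ‖F x‖ ≤ ‖∑ c, ‖A c (t, x)‖‖ := by
      intro x
      rw [Real.norm_of_nonneg (Finset.sum_nonneg fun c _ => norm_nonneg _)]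
      simpa only [Real.norm_eq_abs] using norm_toLp_le_sum_abs fun c => A c (t, x)
    have hFm : MemLp F 2 (volume.restrict BR) :=
      hgL.of_le hFmeas (Eventually.of_forall hFle)
    have hFn : eLpNorm F 2 (volume.restrict BR) ≤ ∑ c, eLpNorm (fun x => A c (t, x)) 2 (volume.restrict BR) := by
      refine (eLpNorm_mono hFle).trans ?_
      have hg_eq : (fun x => ∑ c, ‖A c (t, x)‖) = ∑ c, fun x => ‖A c (t, x)‖ := by
        funext x; simp [Finset.sum_apply]
      rw [hg_eq]
      refine (eLpNorm_sum_le (fun c _ => (hAt c).1.norm) one_le_two).trans (le_of_eq ?_)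
      exact Finset.sum_congr rfl fun c _ => eLpNorm_norm _
    -- the sliced identity in the form of `exists_weakGrad_of_veryWeak`
    have hidt : ∀ φ : EuclideanSpace ℝ (Fin 3) → ℝ, IsTestFunctionOn ΩR φ →
        ∫ x in BR, U (t, x) * (Δ φ) x = -∫ x in BR, ⟪F x, gradient φ x⟫ := by
      intro φ hφ
      have h1 := hsl φ hφ
      have hz1 : ∀ x ∉ BR, U (t, x) * (Δ φ) x = 0 := by
        intro x hx
        have hx' : x ∉ tsupport φ := fun h' => hx (hφ.tsupport_subset h')
        rw [laplacian_eq_sum_sderivs (hφ.contDiff.of_le (by norm_cast))]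
        simp [sderivs_eq_zero_of_notMem_tsupport _ hx']
      have hz2 : ∀ x ∉ BR, ⟪F x, gradient φ x⟫ = 0 := by
        intro x hx
        have hx' : x ∉ tsupport φ := fun h' => hx (hφ.tsupport_subset h')
        have : fderiv ℝ φ x = 0 := fderiv_of_notMem_tsupport (𝕜 := ℝ) hx'
        simp [gradient, this]
      rw [setIntegral_eq_integral_of_forall_compl_eq_zero hz1,
        setIntegral_eq_integral_of_forall_compl_eq_zero hz2, h1]
      have hint : ∀ c, Integrable (fun x => A c (t, x) * fderiv ℝ φ x (e c))
          (volume : Measure (EuclideanSpace ℝ (Fin 3))) := by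
        intro c
        have hφ1 : Continuous fun x => fderiv ℝ φ x (e c) :=
          (hφ.contDiff.continuous_fderiv (by simp)).clm_apply continuous_const
        have := integrable_mul_of_eq_zero_off_compact hφ.hasCompactSupport hφ1
          (fun x hx => by simp [fderiv_of_notMem_tsupport (𝕜 := ℝ) hx])
          (IntegrableOn.mono_set ((hAt c).integrable one_le_two) hφ.tsupport_subset)
        simpa only [mul_comm] using this
      rw [← integral_finsetSum _ fun c _ => hint c]
      congr 1
      refine integral_congr_ae (Eventually.of_forall fun x => ?_)
      dsimp only
      rw [inner_gradient_eq_sum_frame (EuclideanSpace.basisFun (Fin 3) ℝ) (F x) φ x]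
      refine Finset.sum_congr rfl fun c _ => ?_
      rw [EuclideanSpace.inner_basisFun_real, hFc]
    obtain ⟨g, hg, hgm, hgn, -⟩ := hC₃ 0 (fun x => U (t, x)) F hUt hFm hidt
    -- the slice of `Ξ` is a test function on `B_ρ`
    have hΞt : IsTestFunctionOn Ωρ (Ξ t) :=
      isTestFunctionOn_slice_of_subset_prod (Q := Qo') (S := I) (Ω := Ωρ) Subset.rfl hΞ t
    have hibp : ∫ x in Bρ, (fderiv ℝ (Ξ t) x (e i)) • U (t, x) = -∫ x in Bρ, Ξ t x • g x (e i) :=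
      hg.integral_fderiv_smul_eq (Ξ t) (e i) hΞt
    have e1 : ∫ x, U (t, x) * fderiv ℝ (Ξ t) x (e i) =
        ∫ x in Bρ, (fderiv ℝ (Ξ t) x (e i)) • U (t, x) := by
      rw [setIntegral_eq_integral_of_forall_compl_eq_zero]
      · exact integral_congr_ae (Eventually.of_forall fun x => by simp [smul_eq_mul, mul_comm])
      · intro x hx
        have hx' : x ∉ tsupport (Ξ t) := fun h' => hx (hΞt.tsupport_subset h')
        simp [fderiv_of_notMem_tsupport (𝕜 := ℝ) hx']
    rw [e1, hibp, enorm_neg]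
    have hgi : AEStronglyMeasurable (fun x => g x (e i)) (volume.restrict Bρ) :=
      (ContinuousLinearMap.apply ℝ ℝ (e i)).continuous.comp_aestronglyMeasurable hgm.1
    have hgi_le : eLpNorm (fun x => g x (e i)) 2 (volume.restrict Bρ) ≤ eLpNorm g 2 (volume.restrict Bρ) := by
      refine eLpNorm_mono fun x => ?_
      calc ‖g x (e i)‖ ≤ ‖g x‖ * ‖e i‖ := (g x).le_opNorm _
        _ = ‖g x‖ := by simp [he]
    calc ‖∫ x in Bρ, Ξ t x • g x (e i)‖ₑ
        ≤ eLpNorm (Ξ t) 2 (volume.restrict Bρ) * eLpNorm (fun x => g x (e i)) 2 (volume.restrict Bρ) := by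
          simpa only [smul_eq_mul] using
            enorm_integral_mul_le_eLpNorm_mul_eLpNorm (p := 2) (q := 2)
              (hΞt.contDiff.continuous.aestronglyMeasurable) hgi
      _ ≤ eLpNorm (Ξ t) 2 (volume.restrict Bρ) * (C₃ * (eLpNorm (fun x => U (t, x)) 2 (volume.restrict BR) +
            ∑ c, eLpNorm (fun x => A c (t, x)) 2 (volume.restrict BR))) := by
          refine mul_le_mul' le_rfl (hgi_le.trans (hgn.trans ?_))
          exact mul_le_mul' le_rfl (add_le_add le_rfl hFn)
      _ = C₃ * (eLpNorm (fun x => U (t, x)) 2 (volume.restrict BR) +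
            ∑ c, eLpNorm (fun x => A c (t, x)) 2 (volume.restrict BR)) *
            eLpNorm (Ξ t) 2 (volume.restrict Bρ) := by ring
  ---------------------------------------------------------------------------------------------
  -- Step 4: the space–time bound (Cauchy–Schwarz in time)
  ---------------------------------------------------------------------------------------------
  set S : ℝ≥0∞ := eLpNorm U 2 (volume.restrict Qs) + ∑ c, eLpNorm (A c) 2 (volume.restrict Qs) with hS
  have hSfin : S ≠ ⊤ := by
    refine ENNReal.add_ne_top.2 ⟨hU.eLpNorm_ne_top, ?_⟩
    exact (ENNReal.sum_lt_top.2 fun c _ => (hA c).eLpNorm_lt_top).ne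
  have hbound : ∀ Ξ : ℝ → EuclideanSpace ℝ (Fin 3) → ℝ, IsSpaceTimeTestOn Qo' Ξ →
      ‖∫ q : ℝ × EuclideanSpace ℝ (Fin 3), U q * fderiv ℝ (Ξ q.1) q.2 (e i)‖ₑ ≤
        C₃ * S * eLpNorm (uncurry Ξ) 2 (volume.restrict Qs') := by
    intro Ξ hΞ
    have hΞQ : IsSpaceTimeTestOn Qo Ξ := hΞ.mono hQo'o
    -- Fubini
    have hint : Integrable (fun q : ℝ × EuclideanSpace ℝ (Fin 3) => U q * fderiv ℝ (Ξ q.1) q.2 (e i))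
        ((volume : Measure ℝ).prod (volume : Measure (EuclideanSpace ℝ (Fin 3)))) := by
      have h := HeatDivForm.integrable_mul_fderiv_test (isOpen_Ioo.prod isOpen_ball) hQfin hU hΞQ (e i)
      rw [Measure.volume_eq_prod] at h
      exact h
    have eF : ∫ q : ℝ × EuclideanSpace ℝ (Fin 3), U q * fderiv ℝ (Ξ q.1) q.2 (e i) =
        ∫ t, ∫ x, U (t, x) * fderiv ℝ (Ξ t) x (e i) := by
      rw [Measure.volume_eq_prod, integral_prod _ hint]
    have hzero : ∀ t ∉ I, (∫ x, U (t, x) * fderiv ℝ (Ξ t) x (e i)) = 0 := by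
      intro t ht
      have hΞt : Ξ t = 0 := funext fun x => hΞ.apply_eq_zero fun h => ht (mem_prod.1 h).1
      simp [hΞt]
    have eI : ∫ t, (∫ x, U (t, x) * fderiv ℝ (Ξ t) x (e i)) =
        ∫ t in I, (∫ x, U (t, x) * fderiv ℝ (Ξ t) x (e i)) :=
      (setIntegral_eq_integral_of_forall_compl_eq_zero hzero).symm
    rw [eF, eI]
    -- measurability and `L²` norms of the slice quantities
    have hΞm : AEStronglyMeasurable (uncurry Ξ) ((volume.restrict I).prod (volume.restrict Bρ)) :=
      hΞ.contDiff.continuous.aestronglyMeasurable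
    have hn_meas : AEMeasurable (fun t => eLpNorm (Ξ t) 2 (volume.restrict Bρ)) (volume.restrict I) := by
      have h := aemeasurable_eLpNorm_slice (U := uncurry Ξ) hΞm
      exact h
    have hn_L2 : (∫⁻ t in I, eLpNorm (Ξ t) 2 (volume.restrict Bρ) ^ (2 : ℝ)) ^ (1 / 2 : ℝ) =
        eLpNorm (uncurry Ξ) 2 (volume.restrict Qs') := by
      have h := lintegral_eLpNorm_slice_rpow (U := uncurry Ξ) hΞm
      rw [hprod']
      exact h
    have hM_meas : AEMeasurable (fun t => eLpNorm (fun x => U (t, x)) 2 (volume.restrict BR) +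
        ∑ c, eLpNorm (fun x => A c (t, x)) 2 (volume.restrict BR)) (volume.restrict I) :=
      hmU_meas.add (Finset.aemeasurable_fun_sum _ fun c _ => hmA_meas c)
    have hM_L2 : (∫⁻ t in I, (eLpNorm (fun x => U (t, x)) 2 (volume.restrict BR) +
        ∑ c, eLpNorm (fun x => A c (t, x)) 2 (volume.restrict BR)) ^ (2 : ℝ)) ^ (1 / 2 : ℝ) ≤ S := by
      have h1 := ENNReal.lintegral_Lp_add_le (μ := volume.restrict I) (p := 2) hmU_meas
        (Finset.aemeasurable_fun_sum Finset.univ fun c _ => hmA_meas c) one_le_two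
      have h2 := lintegral_Lp_finset_sum_le (μ' := volume.restrict I) (p := 2) one_le_two Finset.univ
        (f := fun c t => eLpNorm (fun x => A c (t, x)) 2 (volume.restrict BR)) (fun c _ => hmA_meas c)
      simp only [Pi.add_apply] at h1
      rw [hmU_L2] at h1
      simp_rw [hmA_L2] at h2
      exact h1.trans (add_le_add le_rfl h2)
    calc ‖∫ t in I, ∫ x, U (t, x) * fderiv ℝ (Ξ t) x (e i)‖ₑ
        ≤ ∫⁻ t in I, ‖∫ x, U (t, x) * fderiv ℝ (Ξ t) x (e i)‖ₑ := enorm_integral_le_lintegral_enorm _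
      _ ≤ ∫⁻ t in I, C₃ * (eLpNorm (fun x => U (t, x)) 2 (volume.restrict BR) +
            ∑ c, eLpNorm (fun x => A c (t, x)) 2 (volume.restrict BR)) *
            eLpNorm (Ξ t) 2 (volume.restrict Bρ) :=
          lintegral_mono_ae (hpt.mono fun t ht => ht Ξ hΞ)
      _ = C₃ * ∫⁻ t in I, (eLpNorm (fun x => U (t, x)) 2 (volume.restrict BR) +
            ∑ c, eLpNorm (fun x => A c (t, x)) 2 (volume.restrict BR)) *
            eLpNorm (Ξ t) 2 (volume.restrict Bρ) := by
          rw [← lintegral_const_mul' _ _ ENNReal.coe_ne_top]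
          simp_rw [mul_assoc]
      _ ≤ C₃ * ((∫⁻ t in I, (eLpNorm (fun x => U (t, x)) 2 (volume.restrict BR) +
            ∑ c, eLpNorm (fun x => A c (t, x)) 2 (volume.restrict BR)) ^ (2 : ℝ)) ^ (1 / 2 : ℝ) *
            (∫⁻ t in I, eLpNorm (Ξ t) 2 (volume.restrict Bρ) ^ (2 : ℝ)) ^ (1 / 2 : ℝ)) := by
          refine mul_le_mul' le_rfl ?_
          have h := ENNReal.lintegral_mul_le_Lp_mul_Lq (volume.restrict I) Real.HolderConjugate.two_two
            hM_meas hn_meas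
          simpa only [Pi.mul_apply] using h
      _ ≤ C₃ * (S * eLpNorm (uncurry Ξ) 2 (volume.restrict Qs')) := by
          rw [hn_L2]
          exact mul_le_mul' le_rfl (mul_le_mul' hM_L2 le_rfl)
      _ = C₃ * S * eLpNorm (uncurry Ξ) 2 (volume.restrict Qs') := by ring
  ---------------------------------------------------------------------------------------------
  -- Step 5: Riesz–Fréchet representation of `Ξ ↦ -∫ U ∂ᵢΞ` on `L²(Q')`
  ---------------------------------------------------------------------------------------------
  haveI : IsFiniteMeasure ((volume : Measure (ℝ × EuclideanSpace ℝ (Fin 3))).restrict Qs') :=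
    isFiniteMeasure_restrict.2 hQ'fin.ne
  have hUQ' : MemLp U 2 (volume.restrict Qs') := hU.mono_measure (Measure.restrict_mono hQ'Q le_rfl)
  set Cr : ℝ := ((C₃ : ℝ≥0∞) * S).toReal with hCr
  have hCr0 : 0 ≤ Cr := ENNReal.toReal_nonneg
  have hCSfin : (C₃ : ℝ≥0∞) * S ≠ ⊤ := ENNReal.mul_ne_top ENNReal.coe_ne_top hSfin
  have hcur : ∀ {θ : ℝ × EuclideanSpace ℝ (Fin 3) → ℝ}, IsTestFunctionOn Qo' θ →
      IsSpaceTimeTestOn Qo' (fun t x => θ (t, x)) := fun hθ => hθ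
  set Λ : (ℝ × EuclideanSpace ℝ (Fin 3) → ℝ) → ℝ := fun θ =>
    -∫ q : ℝ × EuclideanSpace ℝ (Fin 3), U q * fderiv ℝ (fun x => θ (q.1, x)) q.2 (e i) with hΛ
  have hintΛ : ∀ {θ : ℝ × EuclideanSpace ℝ (Fin 3) → ℝ}, IsTestFunctionOn Qo' θ →
      Integrable (fun q : ℝ × EuclideanSpace ℝ (Fin 3) => U q * fderiv ℝ (fun x => θ (q.1, x)) q.2 (e i))
        (volume : Measure (ℝ × EuclideanSpace ℝ (Fin 3))) := fun hθ =>
    HeatDivForm.integrable_mul_fderiv_test (isOpen_Ioo.prod isOpen_ball) hQ'fin hUQ' (hcur hθ) (e i)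
  have hdiff : ∀ {θ : ℝ × EuclideanSpace ℝ (Fin 3) → ℝ}, IsTestFunctionOn Qo' θ →
      ∀ q : ℝ × EuclideanSpace ℝ (Fin 3), DifferentiableAt ℝ (fun x => θ (q.1, x)) q.2 := fun hθ q =>
    (((hcur hθ).contDiff_slice q.1).differentiable (by simp)) q.2
  have hadd : ∀ f g' : ℝ × EuclideanSpace ℝ (Fin 3) → ℝ, IsTestFunctionOn Qo' f →
      IsTestFunctionOn Qo' g' → Λ (f + g') = Λ f + Λ g' := by
    intro f g' hf hg'
    simp only [hΛ]
    rw [← neg_add, ← integral_add (hintΛ hf) (hintΛ hg')]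
    congr 1
    refine integral_congr_ae (Eventually.of_forall fun q => ?_)
    have : (fun x => (f + g') (q.1, x)) = (fun x => f (q.1, x)) + fun x => g' (q.1, x) := rfl
    show U q * fderiv ℝ (fun x => (f + g') (q.1, x)) q.2 (e i) =
      U q * fderiv ℝ (fun x => f (q.1, x)) q.2 (e i) + U q * fderiv ℝ (fun x => g' (q.1, x)) q.2 (e i)
    rw [this, fderiv_add (hdiff hf q) (hdiff hg' q)]
    simp only [_root_.add_apply]
    ring
  have hsmul : ∀ (a : ℝ) (f : ℝ × EuclideanSpace ℝ (Fin 3) → ℝ), IsTestFunctionOn Qo' f →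
      Λ (a • f) = a * Λ f := by
    intro a f hf
    simp only [hΛ]
    rw [mul_neg, ← integral_const_mul]
    congr 1
    refine integral_congr_ae (Eventually.of_forall fun q => ?_)
    have : (fun x => (a • f) (q.1, x)) = a • fun x => f (q.1, x) := rfl
    show U q * fderiv ℝ (fun x => (a • f) (q.1, x)) q.2 (e i) =
      a * (U q * fderiv ℝ (fun x => f (q.1, x)) q.2 (e i))
    rw [this, fderiv_const_smul (hdiff hf q)]
    simp only [_root_.smul_apply, smul_eq_mul]
    ring
  have hbd : ∀ f : ℝ × EuclideanSpace ℝ (Fin 3) → ℝ, IsTestFunctionOn Qo' f →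
      |Λ f| ≤ Cr * (eLpNorm f 2 (volume.restrict Qs')).toReal := by
    intro f hf
    simp only [hΛ, abs_neg]
    have h := hbound (fun t x => f (t, x)) (hcur hf)
    have hu : uncurry (fun t x => f (t, x)) = f := rfl
    rw [hu] at h
    have hf2 : MemLp f 2 (volume.restrict Qs') :=
      (hf.contDiff.continuous.memLp_of_hasCompactSupport hf.hasCompactSupport).restrict _
    have hfin : (C₃ : ℝ≥0∞) * S * eLpNorm f 2 (volume.restrict Qs') ≠ ⊤ :=
      ENNReal.mul_ne_top hCSfin hf2.eLpNorm_ne_top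
    have h' := ENNReal.toReal_mono hfin h
    rw [Real.enorm_eq_ofReal_abs, ENNReal.toReal_ofReal (abs_nonneg _), ENNReal.toReal_mul] at h'
    exact h'
  obtain ⟨G₀, hG₀m, hG₀n, hrep⟩ := HeatDivForm.exists_memLp_two_repr_of_test_bound
    (volume : Measure (ℝ × EuclideanSpace ℝ (Fin 3))) Qo' Λ hadd hsmul hCr0 hbd
  set G : ℝ × EuclideanSpace ℝ (Fin 3) → ℝ := Qs'.indicator G₀ with hG
  have hGG₀ : G =ᵐ[volume.restrict Qs'] G₀ := indicator_ae_eq_restrict hQ'meas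
  have hGm : MemLp G 2 (volume.restrict Qs') := hG₀m.ae_eq hGG₀.symm
  refine ⟨G, hGm, ?_, ?_⟩
  · rw [eLpNorm_congr_ae hGG₀]
    refine hG₀n.trans ?_
    rw [hCr, ENNReal.ofReal_toReal hCSfin]
  · refine ⟨hUli.mono_set hQ'Q, IntegrableOn.locallyIntegrableOn (hGm.integrable one_le_two),
      fun Ξ hΞ => ?_⟩
    have h := hrep (uncurry Ξ) hΞ
    simp only [hΛ] at h
    have h' : -∫ q : ℝ × EuclideanSpace ℝ (Fin 3), U q * fderiv ℝ (Ξ q.1) q.2 (e i) =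
        ∫ q in Qs', G₀ q * Ξ q.1 q.2 := h
    have hGint : ∫ q : ℝ × EuclideanSpace ℝ (Fin 3), G q * Ξ q.1 q.2 = ∫ q in Qs', G₀ q * Ξ q.1 q.2 := by
      rw [← integral_indicator hQ'meas]
      refine integral_congr_ae (Eventually.of_forall fun q => ?_)
      simp only [hG]
      by_cases hq : q ∈ Qs'
      · simp [indicator_of_mem hq]
      · simp [indicator_of_notMem hq]
    rw [derivs_singleton, List.length_singleton, pow_one, hGint, ← h']
    ring

end Poisson

end RepDeriv

end Literature.Analysis.FluidPDE

end
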